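import Summits.QuantumFields.Balaban3D.Carriers.Pieces

/-!
# `Summit.QuantumFields.Balaban3D.Proofs.TowerAC` — the Sect. B tower objects of [Balaban1985UV3] over UNCAPPED masses: the twin of
# seat p1's `Carriers.Histories.HistWeights` / `Carriers.Tower.TowerInput` / `Carriers.Pieces.pieces3` with the mass bound `≤ 1` REMOVED,
# for averagings that are merely absolutely continuous (`Carriers.AvgAC`) — lane `pub-balaban3d`, seat alpha-1 (definition request
# `defn-AlphaInputsT3AC` of route `UnitScaleTilt`, cell ym3-torus)

WHY (seat finding F-α1-1, see `…Proofs.MassesAC`).  With `Ū` only absolutely continuous the masses of (41) are the exact Radon–Nikodym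
transports `T_k[w·m_k]` (`MassesAC.massRecAC`), which carry the local Jacobians of `Ū` and are NOT `≤ 1`; seat p1's interface record
`HistWeights` demands `mass ≤ 1` (a field consumed only by Theorem 1's large-field resummation `lf_dominated`, never by Theorem 2), and
`TowerInput.W : HistWeights`.  This file re-types the mass-carrying layer WITHOUT that field — `HistWeightsAC` (masses `≥ 0`, `m_0 = 1`),
`LFAC` (the functional of (41), monotone and shift-covariant: all the spine's `SectB.TowerObjects` / LQB `B10.TowerRun` ask), `TowerInputAC`
(= `TowerInput` with `W : HistWeightsAC`), `towerWith`/`tower3` (the spine's tower objects INHABITED over seat p1's `run3`, which needs only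
`AvgAC`), `pieces3` — so that everything downstream of the spine (`B10.Ineq41/47`, `B10SectAGathering.StepPieces/StepLeaves`,
`thm2_of_leaves`) applies verbatim.  Definitions are field-for-field those of `Carriers.Tower`/`Carriers.Pieces`; [folklore] bookkeeping,
nothing of CMP 102 asserted.
-/

open MeasureTheory

namespace Summit.QuantumFields.Balaban3D.Proofs.TowerAC

open Literature.MathematicalPhysics.QuantumFieldTheory.Balaban1983to89
open Literature.MathematicalPhysics.QuantumFieldTheory.Balaban1985CMP102
open Literature.MathematicalPhysics.QuantumFieldTheory.Balaban1985CMP102.Setting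
open Summit.QuantumFields.Balaban3D.Carriers

/-! ## §1 Uncapped history masses and the functional of (41) -/

section Weights

variable (P : Params) (G : Type)

/-- THE MASSES of the histories WITHOUT the `[0,1]` pin: `mass k h U ≥ 0` = print's «Σ_{{Ω_j}}∫dV_{k−1}↾_{Z_{k−1}} δ(V̄_{k−1}V^{−1}) ⋯ χζ ⋯» of
(41) for the history `h` at the field `U`, as exact iterated transports (inhabited by `MassesAC.massRecAC`, `…Proofs.StandardAC`); at `k = 0`
mass `1` (R-K0).  Twin of `Carriers.HistWeights` minus `mass_le_one`. [cite: Balaban1985UV3, (41) p.266] -/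
structure HistWeightsAC where
  /-- `m_k(h, U)` -/
  mass : (k : ℕ) → Hist P k → GaugeField P k G → ℝ
  /-- masses are non-negative -/
  mass_nonneg : ∀ k h U, 0 ≤ mass k h U
  /-- at `k = 0` the unique history has mass `1` -/
  mass_zero : ∀ (h : Hist P 0) (U : GaugeField P 0 G), mass 0 h U = 1

variable {P G}

/-- **THE OUTER FUNCTIONAL OF (41)** applied to `exp ∘ F`: `LFAC W k U F = Σ_h m_k(h,U)·exp(F h)` (twin of `Carriers.LF`). [cite: Balaban1985UV3, (41) p.266] -/
noncomputable def LFAC (W : HistWeightsAC P G) (k : ℕ) (U : GaugeField P k G) (F : Hist P k → ℝ) : ℝ :=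
  ∑ h : Hist P k, W.mass k h U * Real.exp (F h)

variable (W : HistWeightsAC P G)

/-- `LFAC` is monotone in the exponent (`TowerRun.lf_mono`). [folklore] -/
theorem lfAC_mono (k : ℕ) (U : GaugeField P k G) (F F' : Hist P k → ℝ) (hFF' : ∀ h, F h ≤ F' h) :
    LFAC W k U F ≤ LFAC W k U F' :=
  Finset.sum_le_sum fun h _ => mul_le_mul_of_nonneg_left (Real.exp_le_exp.mpr (hFF' h)) (W.mass_nonneg k h U)

/-- `LFAC (F + t) = eᵗ · LFAC F` (`TowerRun.lf_shift`). [folklore] -/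
theorem lfAC_shift (k : ℕ) (U : GaugeField P k G) (F : Hist P k → ℝ) (t : ℝ) :
    LFAC W k U (fun h => F h + t) = Real.exp t * LFAC W k U F := by
  unfold LFAC
  rw [Finset.mul_sum]
  refine Finset.sum_congr rfl fun h _ => ?_
  rw [Real.exp_add]; ring

/-- `LFAC ≥ 0`. [folklore] -/
theorem lfAC_nonneg (k : ℕ) (U : GaugeField P k G) (F : Hist P k → ℝ) : 0 ≤ LFAC W k U F :=
  Finset.sum_nonneg fun h _ => mul_nonneg (W.mass_nonneg k h U) (Real.exp_pos _).le

/-- The k = 0 contract (R-K0): `LFAC 0 U F = exp (F (triv 0))`. [folklore] -/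
theorem lfAC_zero (U : GaugeField P 0 G) (F : Hist P 0 → ℝ) : LFAC W 0 U F = Real.exp (F (Hist.triv P 0)) := by
  unfold LFAC
  rw [Fintype.sum_unique]
  rw [W.mass_zero, one_mul, Hist.eq_triv_zero (default : Hist P 0)]

/-- One history's term is one summand of `LFAC` (used at the trivial history: the (47)-term inside (41)). [folklore] -/
theorem mass_mul_exp_le_lfAC (k : ℕ) (h : Hist P k) (U : GaugeField P k G) (F : Hist P k → ℝ) :
    W.mass k h U * Real.exp (F h) ≤ LFAC W k U F := by
  unfold LFAC
  exact Finset.single_le_sum (f := fun h => W.mass k h U * Real.exp (F h))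
    (fun h _ => mul_nonneg (W.mass_nonneg k h U) (Real.exp_pos _).le) (Finset.mem_univ _)

end Weights

/-! ## §2 The tower input over uncapped masses and the spine's tower objects inhabited -/

/-- THE INPUT OF THE AC TOWER CONSTRUCTION: seat p1's `Carriers.TowerInput` field for field, with the masses `W : HistWeightsAC` (no `≤ 1`).
[cite: Balaban1985UV3, (38)–(43) p.266] -/
structure TowerInputAC {L : ℕ} (S : Scales L) (G : Type) [GaugeGroup G] [MeasurableSpace G] [HaarData G] where
  /-- `ε₁` of (4)/(7), per step -/
  ε₁ : ℕ → ℝ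
  /-- the averaging family `Ū` -/
  av : ∀ j, Averaging S.P j G
  /-- `Ū` measurable with `Ū_*(dU) ≪ dV`, every level -/
  avgAC : ∀ j, AvgAC (av j).avg
  /-- regular classes of [7] -/
  reg : ℕ → Set (GaugeField S.P 0 G)
  /-- minimizers `U_k(V)` of [7] Thm 1, `k ≥ 1` -/
  Uk : (k : ℕ) → GaugeField S.P (k + 1) G → GaugeField S.P 0 G
  /-- R-RN lower barriers -/
  lower : (k : ℕ) → Density S.P (k + 1) G
  /-- R-RN upper barriers -/
  upper : (k : ℕ) → Density S.P (k + 1) G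
  /-- `0 ≤ lower` -/
  lower_nonneg : ∀ k V, 0 ≤ lower k V
  /-- `0 ≤ upper` -/
  upper_nonneg : ∀ k V, 0 ≤ upper k V
  /-- big-block size `M₁` -/
  M₁ : ℕ
  /-- collar profile `⌈R₁ r(g_j)⌉·M₁` -/
  Rcol : ℕ → ℕ
  /-- `b₀` of `p(g)` -/
  b₀ : ℝ
  /-- `p₀` of `p(g)` -/
  p₀ : ℝ
  /-- `κ₀` of the remainders -/
  κ₀ : ℝ
  /-- the UNCAPPED masses of the histories -/
  W : HistWeightsAC S.P G
  /-- the composite minimizer `U_k(V, h)` of (42) per history -/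
  UkH : (k : ℕ) → Hist S.P k → GaugeField S.P k G → GaugeField S.P 0 G
  /-- at the trivial history it is `U_k(V)` -/
  UkH_triv : ∀ (k : ℕ) (V : GaugeField S.P k G), UkH k (Hist.triv S.P k) V = ukAll Uk k V
  /-- the interaction sum of (43) per history -/
  Pint : (k : ℕ) → Hist S.P k → GaugeField S.P k G → ℝ
  /-- the coefficient profile of the `|Z_j|`-terms of (41) -/
  zcoef : ℕ → ℝ
  /-- the coefficient profile of the remainder terms of (41)/(47) -/
  rcoef : ℕ → ℝ
  /-- the vacuum-energy profile `E^{(j)}` of (62) -/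
  Estep : ℕ → ℝ

namespace TowerInputAC

variable {L : ℕ} {S : Scales L} {G : Type} [GaugeGroup G] [MeasurableSpace G] [HaarData G] (D : TowerInputAC S G)

/-- The run input of the AC tower: `E := E₀ = Σ_{j<K} E^{(j)}` ((64), ruling R-E) and a given (41)/(47) slot — seat p1's `RunInput`, which asks
only `AvgAC` of the averaging. [cite: Balaban1985UV3, (64) p.273] -/
def toRunInput (slot : ℕ → Prop) : RunInput S G where
  E := B10.Ek D.Estep S.K 0
  ε₁ := D.ε₁
  av := D.av
  avgAC := D.avgAC
  reg := D.reg
  Uk := D.Uk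
  ineq41_47 := slot
  lower := D.lower
  upper := D.upper
  lower_nonneg := D.lower_nonneg
  upper_nonneg := D.upper_nonneg

/-- `run3`'s `U_k` is `ukAll` (definitional, both cases). [folklore] -/
theorem ukAll_eq (slot : ℕ → Prop) : ∀ (k : ℕ) (V : GaugeField S.P k G),
    (run3 (D.toRunInput slot)).Uk k V = ukAll D.Uk k V
  | 0, _ => rfl
  | _ + 1, _ => rfl

/-- STAGE 1 (ruling R-SLOT): the spine's `SectB.TowerObjects` over seat p1's constructed run `run3` with a GIVEN slot, the functional `LFAC` of
the uncapped masses, the regions/volumes of `Carriers.Regions` — `Carriers.TowerInput.towerWith` field for field. [cite: Balaban1985UV3, (38)–(43) p.266] -/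
noncomputable def towerWith (slot : ℕ → Prop) : SectB.TowerObjects S G where
  toRunObjects := run3 (D.toRunInput slot)
  M₁ := D.M₁
  b₀ := D.b₀
  p₀ := D.p₀
  κ₀ := D.κ₀
  Hist := Hist S.P
  triv := Hist.triv S.P
  LF := fun k V F => LFAC D.W k V F
  lf_mono := fun k V F F' h => lfAC_mono D.W k V F F' h
  lf_shift := fun k V F t => lfAC_shift D.W k V F t
  UkH := D.UkH
  UkH_triv := fun k V => by rw [D.UkH_triv, ukAll_eq]
  Pint := D.Pint
  Λvol := fun k h => min (LamVol D.M₁ D.Rcol k h : ℝ) (S.sites k)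
  Λvol_le := fun k h => min_le_right _ _
  plaqsIn := fun k h => {p | plaqCover p ⊆ Omega D.M₁ D.Rcol k h k}
  plaqsIn_triv := fun k => by
    ext p
    simp only [Set.mem_setOf_eq, Set.mem_univ, iff_true]
    rw [Omega_triv]
    exact Set.subset_univ _
  Zvol := fun k h j => (ZVol D.M₁ D.Rcol k h j : ℝ)
  Zvol_triv := fun k j => by simp [ZVol_triv]
  zcoef := D.zcoef
  rcoef := D.rcoef
  Estep := D.Estep
  E_eq := rfl

/-- STAGE 2 (ruling R-SLOT): pin the slot to the typed (41) ∧ (47) of the stage-1 tower (spine's `TowerObjects.pin`). [cite: Balaban1985UV3, (41)/(47) pp.266–267] -/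
noncomputable def tower3 : SectB.TowerObjects S G := (D.towerWith fun _ => True).pin

/-- `SpecOK` for the AC tower is the spine's `SectB.TowerObjects.specOK_pin (D.towerWith fun _ => True)` (`tower3` unfolds to that `pin`);
(6) for its run is seat p1's `run3_eq6 (D.toRunInput _)`; both BY NAME, not restated (gate dedup).  What IS recorded here: the tower's
densities (any slot) are dV-a.e. the PLAIN iterated Radon–Nikodym version `Carriers.rhoSeq` of `T^kρ₀` — the honesty of the version
selection (seat p1's `run3_rho_ae_eq_rhoSeq`), the bridge to constructions that iterate `rnTransport` with no selection (the T³ family's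
`towerDensity`). [folklore] -/
theorem towerWith_rho_ae_eq_rhoSeq (slot : ℕ → Prop) (k : ℕ) :
    (D.towerWith slot).rho k =ᵐ[fieldMeasure S.P k G] rhoSeq D.av (wilsonStart S.P G S.g0sq (B10.Ek D.Estep S.K 0)) k :=
  run3_rho_ae_eq_rhoSeq (D.toRunInput slot) k

/-- The same for the pinned tower `tower3` (its densities are `towerWith`'s, spine's `pin_rho`). [folklore] -/
theorem tower3_rho_ae_eq_rhoSeq (k : ℕ) :
    D.tower3.rho k =ᵐ[fieldMeasure S.P k G] rhoSeq D.av (wilsonStart S.P G S.g0sq (B10.Ek D.Estep S.K 0)) k := by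
  rw [show D.tower3.rho k = (D.towerWith fun _ => True).rho k from SectB.TowerObjects.pin_rho _ k]
  exact D.towerWith_rho_ae_eq_rhoSeq _ k

/-- The k = 0 contract of the tower (ruling R-K0), any slot: one history, `LF 0 V F = exp (F triv)`. [folklore] -/
theorem towerWith_lf_zero (slot : ℕ → Prop) (V : GaugeField S.P 0 G) (F : Hist S.P 0 → ℝ) :
    (D.towerWith slot).LF 0 V F = Real.exp (F (Hist.triv S.P 0)) := lfAC_zero D.W V F

/-- Past volumes along the history projection, any slot: `Zvol k (proj h) j = Zvol (k+1) h j` for `j < k` (the `hpast` of the Z-term leaf). [folklore] -/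
theorem towerWith_Zvol_proj (slot : ℕ → Prop) (k : ℕ) (h : Hist S.P (k + 1)) (j : ℕ) (hj : j < k) :
    (D.towerWith slot).Zvol k (Hist.proj h) j = (D.towerWith slot).Zvol (k + 1) h j := by
  show ((ZVol D.M₁ D.Rcol k h.proj j : ℕ) : ℝ) = ((ZVol D.M₁ D.Rcol (k + 1) h j : ℕ) : ℝ)
  rw [ZVol_succ_of_lt D.M₁ D.Rcol h hj]

/-! ## §3 The step pieces of the AC tower -/

/-- **`StepPieces (tower3 D) k` INHABITED** for the AC tower — `Carriers.TowerInput.pieces3` field for field: histories project by `Hist.proj`,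
`Zvol h := |Z_k(h)|` = `Carriers.ZVol … (k+1) h k`, the counts/constants from `PiecesParams`, the analytic pieces from `StepData`.
[cite: Balaban1985UV3, (22)–(36) pp.261–265; (55)–(62) pp.269–271] -/
noncomputable def pieces3 (k : ℕ) (E : StepData S G k) (C : PiecesParams S k) :
    B10SectAGathering.StepPieces D.tower3.toTowerRun k where
  proj := fun h => Hist.proj h
  proj_triv := Hist.proj_triv (P := S.P) k
  Zvol := fun h => (ZVol D.M₁ D.Rcol (k + 1) h k : ℝ)
  Zvol_nonneg := fun _ => Nat.cast_nonneg _
  Zvol_triv := by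
    show ((ZVol D.M₁ D.Rcol (k + 1) (Hist.triv S.P (k + 1)) k : ℕ) : ℝ) = 0
    rw [ZVol_triv]; simp
  starB := C.starB
  starT := C.starT
  logσ₀ := C.logσ₀
  dg := C.dg
  dg_nonneg := C.dg_nonneg
  logZU := E.logZU
  logZ1 := E.logZ1
  logZT := E.logZT
  logFl := E.logFl
  PprU := E.PprU
  Ppr1 := E.Ppr1
  PprT := E.PprT
  PY := E.PY
  PYZ := E.PYZ
  Pold := E.Pold
  PoldIn := E.PoldIn
  rem := C.rem
  rem_nonneg := C.rem_nonneg

/-- The pieces' `Zvol` IS the tower's `Zvol (k+1) h k` (definitional). [folklore] -/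
theorem pieces3_Zvol (k : ℕ) (E : StepData S G k) (C : PiecesParams S k) (h : Hist S.P (k + 1)) :
    (D.pieces3 k E C).Zvol h = D.tower3.Zvol (k + 1) h k := rfl

/-- The pieces' history projection is `Hist.proj` (definitional). [folklore] -/
theorem pieces3_proj (k : ℕ) (E : StepData S G k) (C : PiecesParams S k) (h : Hist S.P (k + 1)) :
    (D.pieces3 k E C).proj h = Hist.proj h := rfl

end TowerInputAC

end Summit.QuantumFields.Balaban3D.Proofs.TowerAC
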